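/-
Copyright (c) 2026 the pub-hodgecm-mathlib formalisation cell (harness21).  Prover seat hodgecm-mathlib-B-p08 (g41): req618 STAGE 1a «FOUR-FRAME» squad
(director s1808; heir LEAD F0P3a-plan (g18) DIRECTIVE b9ecbbedecc9c5ae D3 day 1 ∕ D7 «B-p08 — A-1 port (incl. `rank_two_shape`)»; dealer LH4-plan (g10) WORD #1 deal g10-#4);
2026-09-03.  PORT (FILE 2 of 2) of the HOME proof cert `F0/P3a/F0P3a-p01/g30/CERT-A1-DefectModuleShape.v1.F0P3ap01g30.lean` §P1 (part), §P4, §P5 (sha16 abad451e204113eb, author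
F0P3a-p01 (g30)): same proofs; the head `defectModuleShape_holds : DefectModuleShape` concludes the ★ «DEFS-1» Prop BY NAME; the defect-set lemmas are stated at rank `N`.
-/
import Literature.NumberTheory.Automorphic.UnitaryThreeFourFrameRankTwoShape     -- ★ FILE 1 (B-p08 (g41) p854560): `rank_two_shape`, `exists_mul_of_v_le`; brings the ★ `CartanUnique` DVR kit
import Literature.NumberTheory.Automorphic.UnitaryThreeFourFrameModuleCriterion  -- ★ A-0 port (B-p04 (g61) p854563): `frameProj_mul_self`, `frameProj_mul_frameProj_of_pairing_eq_zero`,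
                                                                                 -- `vecMul_dotProduct_eq_pairing`; brings ★ «DEFS-1» `UnitaryThreeFourFrameDefs` (`frameProj`, `defectSet`,
                                                                                 -- `AxisStable`, `IsFourFrameFamily`, `DefectModuleShape`) and ★ `UnitaryLatticeTreeDefs` (`latt`, `IsIntMatrix`, `pairing`)
import Literature.NumberTheory.Automorphic.UnitaryLatticeTreeFixedVertex         -- ★ `UnitaryLatticeTree.exists_isIntMatrix_pow_smul` (powers of `ϖ` integralise a matrix)
import Literature.NumberTheory.Automorphic.UnitaryLatticeTreeDual                -- ★ `latt_le_latt_iff` (`latt A ≤ latt A′ ↔ A′⁻¹A` integral)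
import HarnessLib

/-!
# The defect module of a lattice in an orthogonal frame has the rank-two shape `M_Λ = 𝔭^{c₁} ⊕ 𝔭^{c₂} + 𝒪·(ϖ^{c₁−k} u, ϖ^{c₂−k})`
# («(D-RAM) FOUR-FRAME» road, unit (i) item A-1: `defectModuleShape_holds : DefectModuleShape`)

Topic `NumberTheory/Automorphic`; namespace `Literature.NumberTheory.Automorphic.UnitaryThreeFourFrame` (the vocabulary namespace of the road = ★ «DEFS-1»
`UnitaryThreeFourFrameDefs`, dealer LH4-plan (g10) WORD #1 g10-#0).  THEOREMS ONLY (no `def`, no instance, no notation, no named fact, no `sorry`); kernel lane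
`--supports stmt-HodgeConjecture-24833`.  Cell `pub/hodgecm-mathlib` (D-0151), crux H413 = `stmt-HodgeConjecture-24833`, route `HCCMUnconditional`; in-house road «(D-RAM)
FOUR-FRAME» under the leaf stub `stub_DyRamCore` (`Cruxes/H413/Lines/F0_P3c_DyadicPaydown.lean` ED. 4 :147), STAGE 1a (director s1808; heir LEAD F0P3a-plan (g18) DIRECTIVE
`F0/P3a/F0P3a-plan/g18/STAGE1a-DIRECTIVE-DRAM-FourFrame.v1.F0P3a-plan-g18.md` b9ecbbedecc9c5ae, D2 §1 item 3 «`stub_CensusDictionary` … consumes unit (i) (A-0 `ModuleCriterion`, A-1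
`DefectModuleShape`, A-2)», D3 day 1 «PORT the three HOME certs to tree support files»; dealer deal g10-#4 «A-1 PORT `…UnitaryThreeFourFrameDefectModuleShape.lean` ::
`defectModuleShape_holds` (+ `rank_two_shape`)»).  This is FILE 2 of the tree PORT of the HOME proof cert `F0/P3a/F0P3a-p01/g30/CERT-A1-DefectModuleShape.v1.F0P3ap01g30.lean`
(abad451e204113eb; author F0P3a-p01 (g30); rc 0 ∕ 0 ∕ 0 ∕ 0, axioms trio) of SIGSHEET v2 `F0/P3c/LH4/LH4-plan/g9/SIGSHEET-DRAM-FourFrame.v2.LH4plang9.lean` c03c627160493264 §A item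
**A-1 `DefectModuleShape`** (book of record memo v1.4 §2 (A)); FILE 1 is ★ `UnitaryThreeFourFrameRankTwoShape` (`rank_two_shape`, the module-algebra core, cert §P3), and the
frame-projection calculus (cert §P1 P1-1…P1-4) is ★ `UnitaryThreeFourFrameModuleCriterion` (A-0 port, cited BY NAME — not re-proved).

THE MATHEMATICS (over the valuation ring `𝒪 = 𝒪[K]` of a field `K` with `Valued K ℤᵐ⁰`; `ϖ` a uniformiser, `|ϖ| = exp(−1)`; `σ : K →+* K`).
* §1 FRAME PROJECTIONS at `Φ₃` (★ H3 `frameProj σ f = (pairing σ Φ₃ f f)⁻¹ • f·(σf)ᵀΦ₃`), the two facts the A-0 port does not carry: `π_f x = (⟨f,x⟩∕N(f))·f`, hence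
  `N(f) ≠ 0 ⇒ π_f ≠ 0`.
* §2 THE DEFECT SET of a column lattice `Λ = latt g = g·𝒪^N` (★ `latt`) for two matrices `P₁, P₂` (rank `N`; at `N = 3` these are ★ H12 `defectSet P₁ P₂ Λ` and ★ H13
  `AxisStable ϖ P Λ c` BY DELTA): `δ ∈ M_Λ ⟺ g⁻¹(δ₁P₁ + δ₂P₂)g ∈ M_N(𝒪)` (★ `latt_mul`, ★ `latt_le_latt_iff`); the AXES `(ϖ^c, 0) ∈ M_Λ ⟺ ϖ^c P₁Λ ⊆ Λ`; `M_Λ` is (the carrier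
  of) an `𝒪`-submodule of `K × K`; for ORTHOGONAL IDEMPOTENTS `P₁, P₂ ≠ 0` it lies in `𝒪 × 𝒪` (ultrametric max-entry bound: `X·A = δ·A` with `X` integral and `A ≠ 0` forces
  `|δ| ≤ 1`, applied to `A = g⁻¹P_ig`); the axis sets are non-empty (★ `exists_isIntMatrix_pow_smul`); whence **`exists_defectSet_latt_eq_span`**: with `c_i` the least axis
  exponents there are `k ≤ min(c₁,c₂)` and a unit `u` with `M_{latt g} = 𝒪(ϖ^{c₁},0) + 𝒪(0,ϖ^{c₂}) + 𝒪(ϖ^{c₁−k}u, ϖ^{c₂−k})` (§2 feeds ★ `rank_two_shape`).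
* §3 HEAD **`defectModuleShape_holds : DefectModuleShape`** (★ «DEFS-1» §A A-1 BY NAME): in a four-frame family the two projections `π_0^{(b)}, π_1^{(b)}` are orthogonal
  idempotents `≠ 0` (★ `frameProj_mul_self`, ★ `frameProj_mul_frameProj_of_pairing_eq_zero`, §1 `frameProj_ne_zero`), so §2 applies; exponents recast in `ℤ`.
HONEST LABEL: HC_CM is proved only modulo the 7 printed citations (2 remaining named inputs: hLiu418 = stmt-HodgeConjecture-24832, h413 = stmt-HodgeConjecture-24833) until
rung 0 closes; this file is count-neutral (unit (i) module algebra of an in-house road; it pays no organ and moves no verdict; the road is registry-moving only on completion).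

## References
* [Lang2002] S. Lang, *Algebra*, rev. 3rd ed., GTM 211 (2002), Ch. III §7, Thm. 7.8 (elementary divisors ∕ stacked bases over a principal ring).
* [Serre1980Trees] J.-P. Serre, *Trees* (1980), Ch. II §1.1 (lattices `g·𝒪^N`; inclusion of lattices = integrality of the transition matrix; the classes `𝔭^a ⊕ 𝔭^b`).
* [Kottwitz1986] R. E. Kottwitz, *Stable trace formula: elliptic singular terms*, Math. Ann. 275 (1986), §3 (lattices fixed by a semisimple element = lattices stable under the order it
  generates — the role of the defect module `M_Λ` in the fixed-vertex census of the road).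
* [Jacobowitz1962] R. Jacobowitz, *Hermitian forms over local fields*, Amer. J. Math. 84 (1962), §4 (Gram matrices, orthogonal bases of a hermitian space).
-/

set_option autoImplicit false

noncomputable section

open scoped Valued WithZero Matrix MatrixGroups
open Literature.NumberTheory.Automorphic Literature.NumberTheory.Automorphic.HermitianLattice
  Literature.NumberTheory.Automorphic.UnitaryLatticeTree Literature.NumberTheory.Automorphic.CartanUnique

namespace Literature.NumberTheory.Automorphic.UnitaryThreeFourFrame

/-! ## §1  Frame projections at `Φ₃` (★ H3 `frameProj`): the projection formula and non-vanishing -/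

section FrameProj

variable {K : Type} [Field K]

/-- The projection formula `π_f x = (⟨f, x⟩ ∕ N(f)) · f` for the ★ frame projection `frameProj σ f` at `Φ₃`. [cite: Jacobowitz1962, §4] -/
theorem frameProj_mulVec (σ : K →+* K) (f x : Fin 3 → K) :
    frameProj σ f *ᵥ x =
      ((pairing σ ((StdForm.antidiagonal 3).over K) f f)⁻¹ * pairing σ ((StdForm.antidiagonal 3).over K) f x) • f := by
  rw [frameProj, Matrix.smul_mulVec, Matrix.vecMulVec_mulVec, vecMul_dotProduct_eq_pairing, op_smul_eq_smul, smul_smul]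

/-- `N(f) ≠ 0 ⇒ π_f ≠ 0` (indeed `π_f f = f ≠ 0`). [cite: Jacobowitz1962, §4] -/
theorem frameProj_ne_zero (σ : K →+* K) {f : Fin 3 → K}
    (hf : pairing σ ((StdForm.antidiagonal 3).over K) f f ≠ 0) : frameProj σ f ≠ 0 := by
  intro h
  have hf0 : f ≠ 0 := by
    rintro rfl
    exact hf (by simp only [map_zero])
  have key := frameProj_mulVec σ f f
  rw [h, Matrix.zero_mulVec, inv_mul_cancel₀ hf, one_smul] at key
  exact hf0 key.symm

end FrameProj

/-! ## §2  The defect set `M_Λ = {δ | (δ₁P₁ + δ₂P₂)·Λ ⊆ Λ}` of a column lattice `Λ = latt g` (rank `N`) -/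

section DefectSet

variable {K : Type*} [Field K] [Valued K ℤᵐ⁰] {N : ℕ}


omit [Valued K ℤᵐ⁰] in
/-- Conjugation is multiplicative: `(g⁻¹Pg)(g⁻¹Qg) = g⁻¹(PQ)g` for `g ∈ GL_N`. [cite: Serre1980Trees, II.1.1] -/
theorem conj_mul_conj (g : GL (Fin N) K) (P Q : Matrix (Fin N) (Fin N) K) :
    (g : Matrix (Fin N) (Fin N) K)⁻¹ * (P * (g : Matrix (Fin N) (Fin N) K)) * ((g : Matrix (Fin N) (Fin N) K)⁻¹ * (Q * (g : Matrix (Fin N) (Fin N) K))) =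
      (g : Matrix (Fin N) (Fin N) K)⁻¹ * (P * Q * (g : Matrix (Fin N) (Fin N) K)) := by
  simp only [Matrix.mul_assoc]
  rw [Matrix.mul_nonsing_inv_cancel_left _ _ (Matrix.isUnits_det_units g)]

/-- MEMBERSHIP IN THE DEFECT SET OF `latt g` ↔ INTEGRALITY OF THE CONJUGATE: `(δ₁P₁ + δ₂P₂)·(g𝒪^N) ⊆ g𝒪^N ↔ g⁻¹(δ₁P₁ + δ₂P₂)g ∈ M_N(𝒪)` (★ `latt_mul`,
★ `latt_le_latt_iff`). [cite: Serre1980Trees, II.1.1] -/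
theorem mem_defectSet_latt_iff (P₁ P₂ : Matrix (Fin N) (Fin N) K) (g : GL (Fin N) K) (δ : K × K) :
    δ ∈ {δ : K × K | (latt (g : Matrix (Fin N) (Fin N) K)).map ((Matrix.toLin' (δ.1 • P₁ + δ.2 • P₂)).restrictScalars 𝒪[K]) ≤
        latt (g : Matrix (Fin N) (Fin N) K)} ↔
      IsIntMatrix ((g : Matrix (Fin N) (Fin N) K)⁻¹ * ((δ.1 • P₁ + δ.2 • P₂) * (g : Matrix (Fin N) (Fin N) K))) := by
  rw [Set.mem_setOf_eq, ← latt_mul, latt_le_latt_iff (Matrix.isUnits_det_units g)]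

/-- AXIS STABILITY OF `latt g` ↔ INTEGRALITY: `ϖ^c P·(g𝒪^N) ⊆ g𝒪^N ↔ ϖ^c · g⁻¹Pg ∈ M_N(𝒪)`. [cite: Serre1980Trees, II.1.1] -/
theorem axisStable_latt_iff (ϖ : K) (P : Matrix (Fin N) (Fin N) K) (g : GL (Fin N) K) (c : ℕ) :
    (latt (g : Matrix (Fin N) (Fin N) K)).map ((Matrix.toLin' (ϖ ^ c • P)).restrictScalars 𝒪[K]) ≤ latt (g : Matrix (Fin N) (Fin N) K) ↔
      IsIntMatrix (ϖ ^ c • ((g : Matrix (Fin N) (Fin N) K)⁻¹ * (P * (g : Matrix (Fin N) (Fin N) K)))) := by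
  rw [← latt_mul, latt_le_latt_iff (Matrix.isUnits_det_units g), Matrix.smul_mul, Matrix.mul_smul]

omit [Valued K ℤᵐ⁰] in
/-- The first axis of the defect set: `(ϖ^c, 0) ∈ M_Λ ↔ ϖ^c P₁ Λ ⊆ Λ`. [cite: Serre1980Trees, II.1.1] -/
theorem mk_zero_mem_defectSet_iff [Valued K ℤᵐ⁰] (ϖ : K) (P₁ P₂ : Matrix (Fin N) (Fin N) K) (Λ : Submodule 𝒪[K] (Fin N → K)) (c : ℕ) :
    ((ϖ ^ c : K), (0 : K)) ∈ {δ : K × K | Λ.map ((Matrix.toLin' (δ.1 • P₁ + δ.2 • P₂)).restrictScalars 𝒪[K]) ≤ Λ} ↔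
      Λ.map ((Matrix.toLin' (ϖ ^ c • P₁)).restrictScalars 𝒪[K]) ≤ Λ := by
  simp only [Set.mem_setOf_eq, zero_smul, add_zero]

omit [Valued K ℤᵐ⁰] in
/-- The second axis of the defect set: `(0, ϖ^c) ∈ M_Λ ↔ ϖ^c P₂ Λ ⊆ Λ`. [cite: Serre1980Trees, II.1.1] -/
theorem zero_mk_mem_defectSet_iff [Valued K ℤᵐ⁰] (ϖ : K) (P₁ P₂ : Matrix (Fin N) (Fin N) K) (Λ : Submodule 𝒪[K] (Fin N → K)) (c : ℕ) :
    ((0 : K), (ϖ ^ c : K)) ∈ {δ : K × K | Λ.map ((Matrix.toLin' (δ.1 • P₁ + δ.2 • P₂)).restrictScalars 𝒪[K]) ≤ Λ} ↔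
      Λ.map ((Matrix.toLin' (ϖ ^ c • P₂)).restrictScalars 𝒪[K]) ≤ Λ := by
  simp only [Set.mem_setOf_eq, zero_smul, zero_add]

/-- THE DEFECT SET IS (the carrier of) AN `𝒪`-SUBMODULE of `K × K` (for any `𝒪`-submodule `Λ ⊆ K^N` and any two matrices). [cite: Kottwitz1986, §3] -/
theorem exists_submodule_coe_eq_defectSet (P₁ P₂ : Matrix (Fin N) (Fin N) K) (Λ : Submodule 𝒪[K] (Fin N → K)) :
    ∃ M : Submodule 𝒪[K] (K × K), (M : Set (K × K)) = {δ : K × K | Λ.map ((Matrix.toLin' (δ.1 • P₁ + δ.2 • P₂)).restrictScalars 𝒪[K]) ≤ Λ} := by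
  have key : ∀ δ : K × K, δ ∈ {δ : K × K | Λ.map ((Matrix.toLin' (δ.1 • P₁ + δ.2 • P₂)).restrictScalars 𝒪[K]) ≤ Λ} ↔
      ∀ m ∈ Λ, (δ.1 • P₁ + δ.2 • P₂).mulVec m ∈ Λ := by
    intro δ
    rw [Set.mem_setOf_eq]
    constructor
    · intro h m hm
      exact h (Submodule.mem_map.2 ⟨m, hm, by rw [LinearMap.restrictScalars_apply, Matrix.toLin'_apply]⟩)
    · intro h x hx
      obtain ⟨m, hm, rfl⟩ := Submodule.mem_map.1 hx
      rw [LinearMap.restrictScalars_apply, Matrix.toLin'_apply]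
      exact h m hm
  refine ⟨{ carrier := {δ : K × K | Λ.map ((Matrix.toLin' (δ.1 • P₁ + δ.2 • P₂)).restrictScalars 𝒪[K]) ≤ Λ}
            add_mem' := fun {a b} ha hb => (key _).2 fun m hm => by
              rw [Prod.fst_add, Prod.snd_add, add_smul, add_smul, add_add_add_comm, Matrix.add_mulVec]
              exact Λ.add_mem ((key a).1 ha m hm) ((key b).1 hb m hm)
            zero_mem' := (key _).2 fun m _ => by
              rw [Prod.fst_zero, Prod.snd_zero, zero_smul, zero_smul, add_zero, Matrix.zero_mulVec]
              exact Λ.zero_mem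
            smul_mem' := fun r {a} ha => (key _).2 fun m hm => by
              change (((r : K) * a.1) • P₁ + ((r : K) * a.2) • P₂).mulVec m ∈ Λ
              rw [mul_smul, mul_smul, ← smul_add, Matrix.smul_mulVec]
              exact Λ.smul_mem r ((key a).1 ha m hm) }, rfl⟩

/-- ULTRAMETRIC MAX-ENTRY BOUND: `X` integral, `A ≠ 0`, `X·A = δ·A` ⟹ `|δ| ≤ 1` (compare the entry of `A` of largest valuation). [cite: Serre1980Trees, II.1.1] -/
theorem v_le_one_of_isIntMatrix_of_mul_eq_smul {X A : Matrix (Fin N) (Fin N) K} (hX : IsIntMatrix X) (hA : A ≠ 0) {δ : K}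
    (h : X * A = δ • A) : Valued.v δ ≤ 1 := by
  classical
  obtain ⟨i₁, j₁, hij₁⟩ : ∃ i j, A i j ≠ 0 := by
    by_contra hno
    refine hA (Matrix.ext fun i j => ?_)
    rw [Matrix.zero_apply]
    by_contra h
    exact hno ⟨i, j, h⟩
  obtain ⟨⟨i₀, j₀⟩, -, hmax⟩ :=
    Finset.exists_max_image (Finset.univ : Finset (Fin N × Fin N)) (fun ij => Valued.v (A ij.1 ij.2)) ⟨(i₁, j₁), Finset.mem_univ _⟩
  have hne : A i₀ j₀ ≠ 0 := by
    intro h0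
    have hij := hmax (i₁, j₁) (Finset.mem_univ _)
    rw [h0, map_zero, le_zero_iff] at hij
    exact hij₁ ((Valuation.zero_iff _).1 hij)
  have hle : Valued.v ((X * A) i₀ j₀) ≤ Valued.v (A i₀ j₀) := by
    rw [Matrix.mul_apply]
    refine Valuation.map_sum_le _ fun l _ => ?_
    rw [map_mul]
    exact (mul_le_mul' (hX i₀ l) (hmax (l, j₀) (Finset.mem_univ _))).trans_eq (one_mul _)
  rw [h, Matrix.smul_apply, smul_eq_mul, map_mul] at hle
  have hpos : 0 < Valued.v (A i₀ j₀) := (Valuation.pos_iff _).2 hne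
  have := (le_mul_inv_iff₀ hpos).2 hle
  rwa [mul_inv_cancel₀ hpos.ne'] at this

/-- `M_{latt g} ⊆ 𝒪 × 𝒪` for ORTHOGONAL IDEMPOTENTS `P₁, P₂ ≠ 0` (`P_iP_j = δ_ij P_i`): multiplying the integral conjugate `g⁻¹(δ₁P₁ + δ₂P₂)g` by `g⁻¹P_ig` isolates `δ_i·g⁻¹P_ig`.
[cite: Kottwitz1986, §3] -/
theorem v_le_one_of_mem_defectSet_latt {P₁ P₂ : Matrix (Fin N) (Fin N) K} (h11 : P₁ * P₁ = P₁) (h22 : P₂ * P₂ = P₂) (h12 : P₁ * P₂ = 0)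
    (h21 : P₂ * P₁ = 0) (hP₁ : P₁ ≠ 0) (hP₂ : P₂ ≠ 0) (g : GL (Fin N) K) {δ : K × K}
    (hδ : δ ∈ {δ : K × K | (latt (g : Matrix (Fin N) (Fin N) K)).map ((Matrix.toLin' (δ.1 • P₁ + δ.2 • P₂)).restrictScalars 𝒪[K]) ≤
        latt (g : Matrix (Fin N) (Fin N) K)}) :
    Valued.v δ.1 ≤ 1 ∧ Valued.v δ.2 ≤ 1 := by
  rw [mem_defectSet_latt_iff] at hδ
  have hconj_ne : ∀ {P : Matrix (Fin N) (Fin N) K}, P ≠ 0 →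
      (g : Matrix (Fin N) (Fin N) K)⁻¹ * (P * (g : Matrix (Fin N) (Fin N) K)) ≠ 0 := by
    intro P hP h0
    apply hP
    rw [← Matrix.mul_nonsing_inv_cancel_right (g : Matrix (Fin N) (Fin N) K) P (Matrix.isUnits_det_units g),
      ← Matrix.mul_nonsing_inv_cancel_left (g : Matrix (Fin N) (Fin N) K) (P * (g : Matrix (Fin N) (Fin N) K)) (Matrix.isUnits_det_units g),
      h0, Matrix.mul_zero, Matrix.zero_mul]
  constructor
  · refine v_le_one_of_isIntMatrix_of_mul_eq_smul hδ (hconj_ne hP₁) ?_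
    rw [conj_mul_conj, add_mul, Matrix.smul_mul, Matrix.smul_mul, h11, h21, smul_zero, add_zero, Matrix.smul_mul, Matrix.mul_smul]
  · refine v_le_one_of_isIntMatrix_of_mul_eq_smul hδ (hconj_ne hP₂) ?_
    rw [conj_mul_conj, add_mul, Matrix.smul_mul, Matrix.smul_mul, h12, h22, smul_zero, zero_add, Matrix.smul_mul, Matrix.mul_smul]

/-! ### The shape of the defect set -/

/-- **THE DEFECT MODULE SHAPE FOR ORTHOGONAL IDEMPOTENTS (rank `N`).**  For a uniformiser `ϖ` (`|ϖ| = exp(−1)`), orthogonal idempotents `P₁, P₂ ≠ 0` in `M_N(K)` and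
every `g ∈ GL_N(K)`: with `c_i` the LEAST `c` such that `ϖ^c P_i·(g𝒪^N) ⊆ g𝒪^N` (they exist), there are `k ≤ min(c₁, c₂)` and a unit `u` with
`{δ | (δ₁P₁ + δ₂P₂)·(g𝒪^N) ⊆ g𝒪^N} = 𝒪(ϖ^{c₁}, 0) + 𝒪(0, ϖ^{c₂}) + 𝒪(ϖ^{c₁−k}u, ϖ^{c₂−k})`.  Proof: §4 puts the defect set in the hypotheses of `rank_two_shape`.
[cite: Lang2002, Ch. III §7 Thm. 7.8] [cite: Kottwitz1986, §3] -/
theorem exists_defectSet_latt_eq_span {ϖ : K} (hϖ : Valued.v ϖ = WithZero.exp (-1 : ℤ)) {P₁ P₂ : Matrix (Fin N) (Fin N) K}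
    (h11 : P₁ * P₁ = P₁) (h22 : P₂ * P₂ = P₂) (h12 : P₁ * P₂ = 0) (h21 : P₂ * P₁ = 0) (hP₁ : P₁ ≠ 0) (hP₂ : P₂ ≠ 0) (g : GL (Fin N) K) :
    ∃ (c₁ c₂ k : ℕ) (u : K), Valued.v u = 1 ∧ k ≤ c₁ ∧ k ≤ c₂ ∧
      IsLeast {c : ℕ | (latt (g : Matrix (Fin N) (Fin N) K)).map ((Matrix.toLin' (ϖ ^ c • P₁)).restrictScalars 𝒪[K]) ≤
        latt (g : Matrix (Fin N) (Fin N) K)} c₁ ∧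
      IsLeast {c : ℕ | (latt (g : Matrix (Fin N) (Fin N) K)).map ((Matrix.toLin' (ϖ ^ c • P₂)).restrictScalars 𝒪[K]) ≤
        latt (g : Matrix (Fin N) (Fin N) K)} c₂ ∧
      {δ : K × K | (latt (g : Matrix (Fin N) (Fin N) K)).map ((Matrix.toLin' (δ.1 • P₁ + δ.2 • P₂)).restrictScalars 𝒪[K]) ≤
          latt (g : Matrix (Fin N) (Fin N) K)} =
        (Submodule.span 𝒪[K] ({((ϖ ^ c₁ : K), (0 : K)), ((0 : K), (ϖ ^ c₂ : K)), (ϖ ^ (c₁ - k) * u, ϖ ^ (c₂ - k))} : Set (K × K)) :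
          Set (K × K)) := by
  classical
  -- the defect set as a submodule of `𝒪 × 𝒪`
  obtain ⟨M, hM⟩ := exists_submodule_coe_eq_defectSet P₁ P₂ (latt (g : Matrix (Fin N) (Fin N) K))
  have hmemM : ∀ δ : K × K, δ ∈ M ↔
      δ ∈ {δ : K × K | (latt (g : Matrix (Fin N) (Fin N) K)).map ((Matrix.toLin' (δ.1 • P₁ + δ.2 • P₂)).restrictScalars 𝒪[K]) ≤
        latt (g : Matrix (Fin N) (Fin N) K)} :=
    fun δ => by rw [← SetLike.mem_coe, hM]
  have hMint : ∀ p ∈ M, Valued.v (p : K × K).1 ≤ 1 ∧ Valued.v (p : K × K).2 ≤ 1 :=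
    fun p hp => v_le_one_of_mem_defectSet_latt h11 h22 h12 h21 hP₁ hP₂ g ((hmemM p).1 hp)
  -- the axis sets are non-empty; their least elements
  have hax : ∀ P : Matrix (Fin N) (Fin N) K, ∃ c : ℕ,
      (latt (g : Matrix (Fin N) (Fin N) K)).map ((Matrix.toLin' (ϖ ^ c • P)).restrictScalars 𝒪[K]) ≤ latt (g : Matrix (Fin N) (Fin N) K) := fun P => by
    obtain ⟨c, hc⟩ := exists_isIntMatrix_pow_smul hϖ ((g : Matrix (Fin N) (Fin N) K)⁻¹ * (P * (g : Matrix (Fin N) (Fin N) K)))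
    exact ⟨c, (axisStable_latt_iff ϖ P g c).2 hc⟩
  obtain ⟨c₁, hc₁⟩ : ∃ c₁, IsLeast {c : ℕ | (latt (g : Matrix (Fin N) (Fin N) K)).map ((Matrix.toLin' (ϖ ^ c • P₁)).restrictScalars 𝒪[K]) ≤
      latt (g : Matrix (Fin N) (Fin N) K)} c₁ :=
    ⟨Nat.find (hax _), Nat.find_spec (hax _), fun c hc => Nat.find_min' _ hc⟩
  obtain ⟨c₂, hc₂⟩ : ∃ c₂, IsLeast {c : ℕ | (latt (g : Matrix (Fin N) (Fin N) K)).map ((Matrix.toLin' (ϖ ^ c • P₂)).restrictScalars 𝒪[K]) ≤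
      latt (g : Matrix (Fin N) (Fin N) K)} c₂ :=
    ⟨Nat.find (hax _), Nat.find_spec (hax _), fun c hc => Nat.find_min' _ hc⟩
  have h₁ : IsLeast {c : ℕ | ((ϖ ^ c : K), (0 : K)) ∈ M} c₁ := by
    have e : {c : ℕ | ((ϖ ^ c : K), (0 : K)) ∈ M} =
        {c : ℕ | (latt (g : Matrix (Fin N) (Fin N) K)).map ((Matrix.toLin' (ϖ ^ c • P₁)).restrictScalars 𝒪[K]) ≤ latt (g : Matrix (Fin N) (Fin N) K)} := by
      ext c
      rw [Set.mem_setOf_eq, Set.mem_setOf_eq, hmemM, mk_zero_mem_defectSet_iff]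
    rw [e]
    exact hc₁
  have h₂ : IsLeast {c : ℕ | ((0 : K), (ϖ ^ c : K)) ∈ M} c₂ := by
    have e : {c : ℕ | ((0 : K), (ϖ ^ c : K)) ∈ M} =
        {c : ℕ | (latt (g : Matrix (Fin N) (Fin N) K)).map ((Matrix.toLin' (ϖ ^ c • P₂)).restrictScalars 𝒪[K]) ≤ latt (g : Matrix (Fin N) (Fin N) K)} := by
      ext c
      rw [Set.mem_setOf_eq, Set.mem_setOf_eq, hmemM, zero_mk_mem_defectSet_iff]
    rw [e]
    exact hc₂
  -- the rank-two shape lemma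
  obtain ⟨k, u, hu, hk₁, hk₂, hEq⟩ := rank_two_shape hϖ M hMint h₁ h₂
  exact ⟨c₁, c₂, k, u, hu, hk₁, hk₂, hc₁, hc₂, by rw [← hM, hEq]⟩

end DefectSet

/-! ## §3  The head: A-1 `DefectModuleShape` BY NAME -/

/-- **A-1 · THE DEFECT MODULE SHAPE HOLDS** (★ «DEFS-1» `DefectModuleShape` = SIGSHEET v2 §A A-1, c03c627160493264 :135; memo v1.4 §2 (A)): for every FOUR-FRAME FAMILY `f` at
`Φ₃`, every frame `b` and every lattice `Λ = latt g` there are the axis exponents `c₁ c₂` (least `c` with `ϖ^c π_i^{(b)} Λ ⊆ Λ`), a glue depth `k` and a GLUING UNIT `u` with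
`M_Λ^{(b)} = 𝔭^{c₁} ⊕ 𝔭^{c₂} + 𝒪·(ϖ^{c₁−k}u, ϖ^{c₂−k})` (exponents in `ℤ`).  Proof: the projections `π_0^{(b)}, π_1^{(b)}` of the `Φ₃`-orthogonal anisotropic basis `f b` are
orthogonal idempotents `≠ 0` (★ `frameProj_mul_self`, ★ `frameProj_mul_frameProj_of_pairing_eq_zero`, `frameProj_ne_zero`), so `exists_defectSet_latt_eq_span` applies (★ H12
`defectSet`, ★ H13 `AxisStable` by delta).  HOME cert abad451e204113eb head, author F0P3a-p01 (g30). [cite: Lang2002, Ch. III §7 Thm. 7.8] [cite: Kottwitz1986, §3] -/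
theorem defectModuleShape_holds : DefectModuleShape := by
  intro K _ _ σ ϖ hϖ f hf b g
  obtain ⟨horth, hnz, -, -, -⟩ := hf b
  obtain ⟨c₁, c₂, k, u, hu, hk₁, hk₂, hc₁, hc₂, hEq⟩ :=
    exists_defectSet_latt_eq_span hϖ (frameProj_mul_self σ (hnz 0)) (frameProj_mul_self σ (hnz 1))
      (frameProj_mul_frameProj_of_pairing_eq_zero σ (horth 0 1 (by decide)))
      (frameProj_mul_frameProj_of_pairing_eq_zero σ (horth 1 0 (by decide)))
      (frameProj_ne_zero σ (hnz 0)) (frameProj_ne_zero σ (hnz 1)) g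
  refine ⟨c₁, c₂, k, u, hu, hc₁, hc₂, ?_⟩
  rw [defectSet, hEq, ← Nat.cast_sub hk₁, ← Nat.cast_sub hk₂, zpow_natCast, zpow_natCast]

end Literature.NumberTheory.Automorphic.UnitaryThreeFourFrame

end
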